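import Literature.NumberTheory.FaltingsSerre.ParamodularTemplate
import Literature.NumberTheory.FaltingsSerre.CriterionProofs
import Literature.NumberTheory.FaltingsSerre.SymplecticLift
import HarnessLib

/-!
# The Faltings–Serre certificate up to a residual change of frame (`J = antiIdAlt4 ℤ₂`)

[BPPTVY] = A. Brumer, A. Pacetti, C. Poor, G. Tornaría, J. Voight, D. S. Yuen, *On the paramodularity of
typical abelian surfaces*, Algebra & Number Theory **13**:5 (2019) 1145–1195 [cite: BrumerEtAl2019].

The schema `Certificate S P J ν ρ₁ ρ₂` (`ParamodularCertificate.lean`) asks for Step 1 of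
[BPPTVY, Alg. 2.4.1 p. 1156] in the strong framed form `residual_eq : ρ̄₁ = ρ̄₂` (equality of maps in
the GIVEN frames).  What a certificate producer actually establishes is [BPPTVY, §2.3 p. 1149,
"Conjugating `ρ₂`, we may assume `ρ̄₁ = ρ̄₂`"]: `ρ̄₂ = ḡ ρ̄₁ ḡ⁻¹` for some `ḡ ∈ Sp₄(𝔽₂) = ι(S₆)` — the
output shape of the residual-rigidity theorems `GSp4F2.exists_conj_of_ker_iff_of_transvection`
(image `S₅(b)`, Route T), `…_of_trace_orderThree` (`S₆`), `…_of_range_S3wrS2` (`S₃ ≀ S₂`, `N = 353`) of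
`ResidualRigidity*.lean`.  By `GSp4F2.exists_symplectic_reframe_framed` (`SymplecticLift.lean`) such a
`ḡ = ι(π)` lifts to `g ∈ GL₄(ℤ₂)` with `gᵀ J g = J`, `J = antiIdAlt4 ℤ_[2]`, and replacing `ρ₂` by
`g ρ₂ g⁻¹` makes the residual representations EQUAL while keeping the similitude data; unramifiedness,
traces and Frobenius characteristic polynomials are frame-invariant.

THIS FILE packages that as a schema variant and its kernel-checked reduction to `Certificate`:
* `ConjCertificate S P ν ρ₁ ρ₂` — `Certificate` with `J := antiIdAlt4 ℤ_[2]` (so `det_isUnit`,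
  `transpose_eq`, `diag_eq` are theorems, not fields) and with `residual_eq` replaced by
  `residual_conj : ∃ π : S₆, ∀ σ, ρ̄₂(σ) = ι(π) ρ̄₁(σ) ι(π)⁻¹`;
* `ConjCertificate.exists_certificate` — `∃ g ∈ Sp_J(ℤ₂)` with `Certificate S P J ν ρ₁ (g ρ₂ g⁻¹)`;
* `SurfaceConjCertificate N T ν ρA ρf` and `paramodular_of_surfaceConjCertificate[_holds]` — the
  instance template of `ParamodularTemplate.lean` with the certificate hypothesis in this form and the
  input `hρf` (the cited `ρ_{f,2}` of [BPPTVY, Thm. 4.3.4]) about `ρf` in ITS OWN frame;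
* the frame-change lemma `FramedRep.trace_conj` [folklore] (private local copies of the tree's
  `FramedRep.charpoly_conj` / `FramedGaloisRep.hasFrobCharpolyAt_conj_iff`, whose home files are heavy
  leaves not imported here).
No new cited fact; everything is proved from the definitions.

## References
* [BPPTVY] §2.3 p. 1149; Alg. 2.4.1 p. 1156; Thm 2.1.5 p. 1150; (5.1.2) p. 1173; Thm 7.1.3 p. 1187.
  [cite: BrumerEtAl2019]
-/

noncomputable section

namespace Literature.NumberTheory.GaloisRepresentations

/-! ## Frame change: the trace -/

section FrameChange

variable {G : Type*} [Group G] [TopologicalSpace G] {A : Type*} [CommRing A] [TopologicalSpace A]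
  [IsTopologicalRing A] {n : ℕ}

/-- The trace is invariant under a change of frame. [folklore] -/
theorem FramedRep.trace_conj (P : GL (Fin n) A) (ρ : FramedRep G A n) (g : G) :
    (FramedRep.conj P ρ).trace g = ρ.trace g := by
  simp only [FramedRep.trace, FramedRep.conj_apply, Units.val_mul, Matrix.trace_units_conj]

end FrameChange

end Literature.NumberTheory.GaloisRepresentations

namespace Literature.NumberTheory.FaltingsSerre

open Matrix Equiv Field IsDedekindDomain
open Literature.NumberTheory.GaloisRepresentations Literature.NumberTheory.FaltingsSerre.GSp4F2
open scoped NumberField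

section FrameChange

variable {G : Type*} [Group G] [TopologicalSpace G] {A : Type*} [CommRing A] [TopologicalSpace A]
  [IsTopologicalRing A] {n : ℕ}

/-- Local copy of `FramedRep.charpoly_conj` (`GlobalTriangulineSpace.lean`, not imported here): the
characteristic polynomial is invariant under a change of frame. [folklore] -/
private theorem charpoly_conj_aux (P : GL (Fin n) A) (ρ : FramedRep G A n) (g : G) :
    (FramedRep.conj P ρ).charpoly g = ρ.charpoly g := by
  simp only [FramedRep.charpoly, FramedRep.conj_apply, Units.val_mul, Matrix.coe_units_inv,
    Matrix.charpoly_units_conj]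

/-- Local copy of `FramedGaloisRep.hasFrobCharpolyAt_conj_iff` (`ReciprocityGLnProofs.lean`, not
imported here): Frobenius characteristic polynomials are invariant under a change of frame. [folklore] -/
private theorem hasFrobCharpolyAt_conj_iff_aux {L : Type*} [Field L] (v : HeightOneSpectrum (𝓞 L))
    (Q : Polynomial A) (P : GL (Fin n) A) (ρ : FramedGaloisRep L A n) :
    FramedGaloisRep.HasFrobCharpolyAt v Q (FramedRep.conj P ρ) ↔ ρ.HasFrobCharpolyAt v Q := by
  refine forall₂_congr fun 𝔓 _ => forall₂_congr fun σ _ => ?_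
  rw [charpoly_conj_aux]

end FrameChange

/-! ## The certificate up to residual conjugacy -/

section Conj

variable {K : Type} [Field K] {S P : Set (HeightOneSpectrum (𝓞 K))}
  {ν : absoluteGaloisGroup K → ℤ_[2]} {ρ₁ ρ₂ : FramedGaloisRep K ℤ_[2] 4}

variable (S P ν ρ₁ ρ₂) in
/-- **The Faltings–Serre certificate up to a residual change of frame** (`G = GSp₄`, `ℓ = 2`,
`J = antiIdAlt4 ℤ_[2]`): the fields of `Certificate S P (antiIdAlt4 ℤ_[2]) ν ρ₁ ρ₂` except that
* `det_isUnit`, `transpose_eq`, `diag_eq` are dropped (theorems for this `J`: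
  `GSp4F2.isUnit_det_antiIdAlt4`, `antiIdAlt4_transpose`, `antiIdAlt4_apply_same`), and
* Step 1 is `residual_conj : ∃ π ∈ S₆, ∀ σ, ρ̄₂(σ) = ι(π) ρ̄₁(σ) ι(π)⁻¹` — "`ρ̄₁ ≃ ρ̄₂`" witnessed inside
  `Sp₄(𝔽₂) = ι(S₆)`, the output of the residual-rigidity theorems — instead of `ρ̄₁ = ρ̄₂`.
The `complete` block mentions `ρ₁` only (through `ρ̄₁`), exactly as in `Certificate`.
[cite: BrumerEtAl2019, §2.3 p. 1149; Alg 2.4.1 p. 1156; Thm 2.1.5 p. 1150] -/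
structure ConjCertificate : Prop where
  /-- `ρ₁(σ)ᵀ J ρ₁(σ) = ν(σ) J`, `J = antiIdAlt4 ℤ_[2]`. -/
  similitude₁ : ∀ σ, IsSimilitude (antiIdAlt4 ℤ_[2]) (ν σ)
    ((ρ₁ σ : GL (Fin 4) ℤ_[2]) : Matrix (Fin 4) (Fin 4) ℤ_[2])
  /-- `ρ₂(σ)ᵀ J ρ₂(σ) = ν(σ) J` (same `ν`). -/
  similitude₂ : ∀ σ, IsSimilitude (antiIdAlt4 ℤ_[2]) (ν σ)
    ((ρ₂ σ : GL (Fin 4) ℤ_[2]) : Matrix (Fin 4) (Fin 4) ℤ_[2])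
  /-- Step 1 up to frame: `ρ̄₂ = ι(π) ρ̄₁ ι(π)⁻¹` for some `π ∈ S₆`. -/
  residual_conj : ∃ π : Perm (Fin 6), ∀ σ,
    residual ρ₂.toMonoidHom σ = iotaGL π * residual ρ₁.toMonoidHom σ * (iotaGL π)⁻¹
  /-- `ρ̄₁` is absolutely irreducible. -/
  absIrreducible : IsAbsIrreducible (residual ρ₁.toMonoidHom)
  /-- `ρ₁` is unramified outside `S`. -/
  unramified₁ : ∀ v ∉ S, ρ₁.IsUnramifiedAt v
  /-- `ρ₂` is unramified outside `S`. -/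
  unramified₂ : ∀ v ∉ S, ρ₂.IsUnramifiedAt v
  /-- Steps 2–4 for `ρ̄₁`: the places of `P` detect every admissible obstructing cocycle. -/
  complete : ∀ μ : absoluteGaloisGroup K → Matrix (Fin 4) (Fin 4) (ZMod 2), IsLocallyConstant μ →
    (∀ σ ∈ inertiaOutside K S, μ σ = 0) →
    ValuedIn (spLie ((antiIdAlt4 ℤ_[2]).map (PadicInt.toZMod (p := 2)))) μ →
    IsDeviationCocycle (residual ρ₁.toMonoidHom) μ → IsObstructing (residual ρ₁.toMonoidHom) μ →
    ∃ σ ∈ frobeniusAt K P, IsObstructingElt (residual ρ₁.toMonoidHom) μ σ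
  /-- Step 5: traces agree at the Frobenius elements of `P` (frame-independent). -/
  traces : ∀ σ ∈ frobeniusAt K P, FramedRep.trace ρ₁ σ = FramedRep.trace ρ₂ σ

/-- A certificate in the strict sense (with `J = antiIdAlt4 ℤ_[2]`) is one up to frame (`π = 1`). [cite: BrumerEtAl2019, Alg 2.4.1 p. 1156] -/
theorem ConjCertificate.ofCertificate (C : Certificate S P (antiIdAlt4 ℤ_[2]) ν ρ₁ ρ₂) :
    ConjCertificate S P ν ρ₁ ρ₂ where
  similitude₁ := C.similitude₁
  similitude₂ := C.similitude₂
  residual_conj := ⟨1, fun σ => by rw [map_one, one_mul, inv_one, mul_one, C.residual_eq]⟩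
  absIrreducible := C.absIrreducible
  unramified₁ := C.unramified₁
  unramified₂ := C.unramified₂
  complete := C.complete
  traces := C.traces

/-- **Re-framing `ρ₂` turns a certificate up to frame into a certificate** [BPPTVY, §2.3 p. 1149]:
there is `g ∈ GL₄(ℤ₂)` with `gᵀ J g = J` such that `(ρ₁, g ρ₂ g⁻¹)` carries a `Certificate` for
`J = antiIdAlt4 ℤ_[2]` with the SAME `S`, `P`, `ν` and the same Steps 2–5 data. [cite: BrumerEtAl2019, §2.3 p. 1149; Alg 2.4.1 p. 1156] -/
theorem ConjCertificate.exists_certificate (C : ConjCertificate S P ν ρ₁ ρ₂) :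
    ∃ g : GL (Fin 4) ℤ_[2], IsSimilitude (antiIdAlt4 ℤ_[2]) 1 (g : Matrix (Fin 4) (Fin 4) ℤ_[2]) ∧
      Certificate S P (antiIdAlt4 ℤ_[2]) ν ρ₁ (FramedRep.conj g ρ₂) := by
  obtain ⟨π, hπ⟩ := C.residual_conj
  obtain ⟨g, hg, hres, hsim⟩ := exists_symplectic_reframe_framed ρ₁ ρ₂ π hπ
  refine ⟨g, hg, ?_⟩
  exact
    { det_isUnit := isUnit_det_antiIdAlt4 ℤ_[2]
      transpose_eq := antiIdAlt4_transpose ℤ_[2]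
      diag_eq := antiIdAlt4_apply_same ℤ_[2]
      similitude₁ := C.similitude₁
      similitude₂ := fun σ => hsim σ (ν σ) (C.similitude₂ σ)
      residual_eq := hres.symm
      absIrreducible := C.absIrreducible
      unramified₁ := C.unramified₁
      unramified₂ := fun v hv =>
        (FramedGaloisRep.isUnramifiedAt_conj_iff v g ρ₂).2 (C.unramified₂ v hv)
      complete := C.complete
      traces := fun σ hσ => by rw [FramedRep.trace_conj]; exact C.traces σ hσ }

end Conj

/-! ## Level-`N` surface certificates up to frame, and the instance template -/

section Surface

open Polynomial Literature.NumberTheory.Automorphic.Paramodular Literature.NumberTheory.Automorphic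
  Literature.AlgebraicGeometry.Motives

/-- **Level-`N` surface certificate up to a residual change of frame**:
`ConjCertificate (placesOver (badPrimes N)) (placesOver T) ν ρA ρf` — the hypothesis a certificate
producer discharges for `J = antiIdAlt4 ℤ_[2]` WITHOUT choosing a frame of `ρf` adapted to `ρ̄A`
(its Step 1 field is the `∃ π` output of the residual-rigidity theorems). [cite: BrumerEtAl2019, Alg 2.4.1 p. 1156; §2.3 p. 1149] -/
def SurfaceConjCertificate (N : ℕ) (T : Finset ℕ) (ν : Field.absoluteGaloisGroup ℚ → ℤ_[2])
    (ρA ρf : FramedGaloisRep ℚ ℤ_[2] 4) : Prop :=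
  ConjCertificate (placesOver (badPrimes N)) (placesOver T) ν ρA ρf

variable {N : ℕ} {T : Finset ℕ} {ν : Field.absoluteGaloisGroup ℚ → ℤ_[2]}
  {ρA ρf : FramedGaloisRep ℚ ℤ_[2] 4}

/-- Re-framing at surface level: a `SurfaceCertificate N T (antiIdAlt4 ℤ_[2]) ν ρA (g ρf g⁻¹)` for some
symplectic `g`. [cite: BrumerEtAl2019, §2.3 p. 1149; Alg 2.4.1 p. 1156] -/
theorem SurfaceConjCertificate.exists_surfaceCertificate (C : SurfaceConjCertificate N T ν ρA ρf) :
    ∃ g : GL (Fin 4) ℤ_[2], IsSimilitude (antiIdAlt4 ℤ_[2]) 1 (g : Matrix (Fin 4) (Fin 4) ℤ_[2]) ∧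
      SurfaceCertificate N T (antiIdAlt4 ℤ_[2]) ν ρA (FramedRep.conj g ρf) :=
  ConjCertificate.exists_certificate C

/-- **`A` is paramodular of level `N` away from `N`, from a surface certificate up to frame.**  Same
binders as `paramodular_of_surfaceCertificate` (`ParamodularTemplate.lean`) except that the
certificate hypothesis is `SurfaceConjCertificate N T ν ρA ρf` (`J = antiIdAlt4 ℤ_[2]`, Step 1 up to
`ι(S₆)`-conjugacy) — and `hρf`, the Frobenius polynomials of the cited `ρ_{f,2}`
[BPPTVY, Thm 4.3.4 + Lemma 4.3.8(b) p. 1171], is about `ρf` in ITS OWN frame: the proof re-frames `ρf` by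
`exists_surfaceCertificate` and transports `hρf` along the frame change
(a local copy of `FramedGaloisRep.hasFrobCharpolyAt_conj_iff`). [cite: BrumerEtAl2019, Thm 7.1.3 p. 1187; §2.3 p. 1149; Thm 2.1.5 p. 1150; Thm 4.3.4 p. 1169] -/
theorem paramodular_of_surfaceConjCertificate (hFS : traceEq_of_faltingsSerre_symplectic)
    [NeZero N] {A : AbelianVariety ℚ} {f : Matrix (Fin 2) (Fin 2) ℂ → ℂ}
    {b : Module.Basis (Fin 4) ℚ_[2] (A.rationalTateModule 2)}
    (hC : SurfaceConjCertificate N T ν ρA ρf)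
    (hframe : A.IsFrameOfTateRep 2 b (rationalize ρA))
    (aA bA af bf : ℕ → ℤ)
    (hA : ∀ p : ℕ, p.Prime → ¬ p ∣ N →
      A.HasGoodEulerFactorAt p ((lPolynomialOfSurface p (aA p) (bA p)).map (Int.castRingHom ℚ)))
    (hρf : ∀ p : ℕ, p.Prime → ¬ p ∣ N → p ≠ 2 →
      ∀ v : HeightOneSpectrum (𝓞 ℚ), ((p : ℕ) : 𝓞 ℚ) ∈ v.asIdeal →
        ρf.HasFrobCharpolyAt v
          ((lPolynomialOfSurface p (af p) (bf p)).reverse.map (Int.castRingHom ℤ_[2])))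
    (hcusp : IsParamodularCuspForm N 2 f) (hne : ∃ Z ∈ siegelUpperHalfSpace 2, f Z ≠ 0)
    (hfe : ∀ p : ℕ, p.Prime → ¬ p ∣ N →
      HasSpinorEulerFactorAt 2 p f ((lPolynomialOfSurface p (af p) (bf p)).map (Int.castRingHom ℂ)))
    (h2 : ¬ 2 ∣ N → aA 2 = af 2 ∧ bA 2 = bf 2) :
    IsParamodularAwayFrom A N f := by
  obtain ⟨g, -, hC'⟩ := hC.exists_surfaceCertificate
  exact paramodular_of_surfaceCertificate hFS hC' hframe aA bA af bf hA
    (fun p hp hpN hp2 v hv =>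
      (hasFrobCharpolyAt_conj_iff_aux v _ g ρf).2 (hρf p hp hpN hp2 v hv))
    hcusp hne hfe h2

/-- The same with the criterion hypothesis `hFS` discharged by
`traceEq_of_faltingsSerre_symplectic_holds` (`CriterionProofs.lean`). [cite: BrumerEtAl2019, Thm 7.1.3 p. 1187; Thm 2.1.5 p. 1150; Thm 4.3.4 p. 1169] -/
theorem paramodular_of_surfaceConjCertificate_holds
    [NeZero N] {A : AbelianVariety ℚ} {f : Matrix (Fin 2) (Fin 2) ℂ → ℂ}
    {b : Module.Basis (Fin 4) ℚ_[2] (A.rationalTateModule 2)}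
    (hC : SurfaceConjCertificate N T ν ρA ρf)
    (hframe : A.IsFrameOfTateRep 2 b (rationalize ρA))
    (aA bA af bf : ℕ → ℤ)
    (hA : ∀ p : ℕ, p.Prime → ¬ p ∣ N →
      A.HasGoodEulerFactorAt p ((lPolynomialOfSurface p (aA p) (bA p)).map (Int.castRingHom ℚ)))
    (hρf : ∀ p : ℕ, p.Prime → ¬ p ∣ N → p ≠ 2 →
      ∀ v : HeightOneSpectrum (𝓞 ℚ), ((p : ℕ) : 𝓞 ℚ) ∈ v.asIdeal →
        ρf.HasFrobCharpolyAt v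
          ((lPolynomialOfSurface p (af p) (bf p)).reverse.map (Int.castRingHom ℤ_[2])))
    (hcusp : IsParamodularCuspForm N 2 f) (hne : ∃ Z ∈ siegelUpperHalfSpace 2, f Z ≠ 0)
    (hfe : ∀ p : ℕ, p.Prime → ¬ p ∣ N →
      HasSpinorEulerFactorAt 2 p f ((lPolynomialOfSurface p (af p) (bf p)).map (Int.castRingHom ℂ)))
    (h2 : ¬ 2 ∣ N → aA 2 = af 2 ∧ bA 2 = bf 2) :
    IsParamodularAwayFrom A N f :=
  paramodular_of_surfaceConjCertificate traceEq_of_faltingsSerre_symplectic_holds hC hframe aA bA af bf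
    hA hρf hcusp hne hfe h2

end Surface

end Literature.NumberTheory.FaltingsSerre

end
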